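import Literature.Geometry.DiscreteGeometry.TwoShellPatterns
import Literature.MathematicalPhysics.StatisticalMechanics.LennardJonesClusters
import Summits.AtomisticToContinuum.Crystallization.Theorems.PhononSlackCertificatesFarFieldGapRStepInvisible

/-!
# Route `PhononSlackCertificates`, crux `FarFieldGapR` (stmt-AtomisticToContinuum-14969), line `Sketch`:
the poisoning step, part 2 — the step (`stub_step`)

ONE POISONING STEP of the octahedral-poisoning collapse `AllBadGap → FarFieldGapR`: in a
`δ`-separated configuration `y` (`0 < δ ≤ 3/5`) with a `1/20`-good particle `i` (witness
`(a, A, P, f)`: the `3a/2`-neighbourhood of `y i` is an `a/20`-match of the rotated, scaled fcc/hcp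
two-shell pattern `y i + a • A P`), the particle inserted at the octahedral hole
`z := y i + a • A h`, `h = e₀/√2`, of the matched frame

1. keeps `δ`-separation (every particle is `≥ a (1/√2 - 1/20) ≥ 0.6176 > 3/5` from `z`);
2. is POISONED — the six octahedron vertices `z ± (a/√2) A eₘ` carry particles within `a/20` —
   and a poisoned particle is INVISIBLE to every goodness witness (`step_invisible`: no witness
   assigns it, no witness has it within its covering radius), so it is bad, creates no good
   particle, and makes `i` bad: the number of good particles drops;
3. costs at most `K(δ) = (2/δ + 1)³ · V_LJ(3/5)` in energy.

The octahedral-hole facts about the two patterns enter as the hypothesis `hH` (stub `stub_hole` of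
the line, landed separately); invisibility (`step_invisible`) is the companion file
`PhononSlackCertificatesFarFieldGapRStepInvisible.lean`.  Finite geometry with explicit margins.
-/

noncomputable section

open scoped BigOperators Classical

namespace Summit.AtomisticToContinuum.Crystallization.Theorems.PhononSlackCertificatesFarFieldGapR

open Literature.MathematicalPhysics.StatisticalMechanics Literature.Geometry.DiscreteGeometry

/-! ## Energy bookkeeping for an appended particle -/

/-- Appending one particle adds exactly its interaction with the old ones:
`𝓔(snoc y z) = 𝓔(y) + ∑ₖ V_LJ(|y k - z|)`. -/
private theorem step_energy_snoc {n : ℕ} (y : Fin n → (EuclideanSpace ℝ (Fin 3))) (z : (EuclideanSpace ℝ (Fin 3))) :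
    interactionEnergy lennardJones (@Fin.snoc n (fun _ => (EuclideanSpace ℝ (Fin 3))) y z) =
      interactionEnergy lennardJones y + ∑ k, lennardJones (dist (y k) z) := by
  rw [Fin.snoc_eq_append, interactionEnergy_append lennardJones lennardJones_zero]
  have h1 : interactionEnergy lennardJones (Fin.cons z Fin.elim0 : Fin 1 → (EuclideanSpace ℝ (Fin 3))) = 0 := by
    haveI : Subsingleton (Fin (0 + 1)) := inferInstanceAs (Subsingleton (Fin 1))
    exact interactionEnergy_of_subsingleton lennardJones _
  rw [h1, add_zero]
  congr 1
  refine Finset.sum_congr rfl fun k _ => ?_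
  rw [Fin.sum_univ_one]
  rfl

/-- `V_LJ` is bounded on `[3/5, ∞)` by its value at `3/5` (decreasing on `(0,1]`, non-positive
beyond `1`). -/
private theorem step_lennardJones_le {r : ℝ} (hr : 3 / 5 ≤ r) :
    lennardJones r ≤ lennardJones (3 / 5) := by
  have hV0 : (0 : ℝ) ≤ lennardJones (3 / 5) := by norm_num [lennardJones]
  by_cases h1 : 1 ≤ r
  · exact (lennardJones_nonpos h1).trans hV0
  · have hr0 : 0 < r := by linarith
    have hu1 : 1 ≤ r⁻¹ ^ 6 := one_le_pow₀ ((one_le_inv₀ hr0).2 (le_of_not_ge h1))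
    have hu2 : r⁻¹ ^ 6 ≤ (3 / 5 : ℝ)⁻¹ ^ 6 :=
      pow_le_pow_left₀ (inv_nonneg.2 hr0.le) (inv_anti₀ (by norm_num) hr) 6
    unfold lennardJones
    have h12 : r⁻¹ ^ 12 = (r⁻¹ ^ 6) ^ 2 := by ring
    have h12' : (3 / 5 : ℝ)⁻¹ ^ 12 = ((3 / 5 : ℝ)⁻¹ ^ 6) ^ 2 := by ring
    rw [h12, h12']
    nlinarith [hu1, hu2]

/-- `0 ≤ V_LJ(3/5)`. -/
private theorem step_lennardJones_three_fifths_nonneg : (0 : ℝ) ≤ lennardJones (3 / 5) := by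
  norm_num [lennardJones]

/-! ## Restricting a goodness witness past an invisible appended particle -/

/-- If the appended particle `z` (index `Fin.last n`) is never assigned by, and lies outside the
covering radius of, every goodness witness of the old particle `k` in `Fin.snoc y z`, then a
goodness witness of `k.castSucc` in `Fin.snoc y z` restricts to a goodness witness of `k` in `y`. -/
private theorem step_good_restrict {n : ℕ} (y : Fin n → (EuclideanSpace ℝ (Fin 3))) (z : (EuclideanSpace ℝ (Fin 3))) (k : Fin n)
    (hgood : IsTwoShellGood (1 / 20) (47 / 50) 1 (@Fin.snoc n (fun _ => (EuclideanSpace ℝ (Fin 3))) y z) k.castSucc)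
    (hinv : ∀ (a' : ℝ) (A' : (EuclideanSpace ℝ (Fin 3)) →ₗᵢ[ℝ] (EuclideanSpace ℝ (Fin 3))) (P' : Finset (EuclideanSpace ℝ (Fin 3))) (f' : (EuclideanSpace ℝ (Fin 3)) → Fin (n + 1)),
      47 / 50 ≤ a' → (P' = fccTwoShellPattern ∨ P' = hcpTwoShellPattern) →
      (∀ v ∈ P', f' v ≠ k.castSucc ∧
        dist (@Fin.snoc n (fun _ => (EuclideanSpace ℝ (Fin 3))) y z (f' v))
          (@Fin.snoc n (fun _ => (EuclideanSpace ℝ (Fin 3))) y z k.castSucc + a' • A' v) ≤ 1 / 20 * a') →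
      (∀ j : Fin (n + 1), j ≠ k.castSucc →
        dist (@Fin.snoc n (fun _ => (EuclideanSpace ℝ (Fin 3))) y z j) (@Fin.snoc n (fun _ => (EuclideanSpace ℝ (Fin 3))) y z k.castSucc) ≤
          3 / 2 * a' → ∃ v ∈ P', f' v = j) →
      ∀ v ∈ P', f' v ≠ Fin.last n) :
    IsTwoShellGood (1 / 20) (47 / 50) 1 y k := by
  obtain ⟨a', ha1', ha2', A', P', f', hP', hf', hinj', hcov'⟩ := hgood
  have hnl := hinv a' A' P' f' ha1' hP' hf' hcov'
  set g : (EuclideanSpace ℝ (Fin 3)) → Fin n := fun v => if hv : f' v = Fin.last n then k else (f' v).castPred hv with hg_def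
  have hg : ∀ v ∈ P', (g v).castSucc = f' v := by
    intro v hv
    simp only [hg_def, dif_neg (hnl v hv)]
    exact Fin.castSucc_castPred _ _
  refine ⟨a', ha1', ha2', A', P', g, hP', fun v hv => ⟨fun hgk => ?_, ?_⟩, ?_, ?_⟩
  · apply (hf' v hv).1
    rw [← hg v hv, hgk]
  · have := (hf' v hv).2
    rwa [← hg v hv, Fin.snoc_castSucc, Fin.snoc_castSucc] at this
  · intro v hv w hw hvw
    apply hinj' hv hw
    rw [← hg v hv, ← hg w hw]
    exact congrArg Fin.castSucc hvw
  · intro j hjk hdist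
    have hj' : j.castSucc ≠ k.castSucc := fun h => hjk (Fin.castSucc_injective _ h)
    have hdist' : dist (@Fin.snoc n (fun _ => (EuclideanSpace ℝ (Fin 3))) y z j.castSucc)
        (@Fin.snoc n (fun _ => (EuclideanSpace ℝ (Fin 3))) y z k.castSucc) ≤ 3 / 2 * a' := by
      rwa [Fin.snoc_castSucc, Fin.snoc_castSucc]
    obtain ⟨v, hv, hfv⟩ := hcov' j.castSucc hj' hdist'
    refine ⟨v, hv, Fin.castSucc_injective _ ?_⟩
    rw [hg v hv, hfv]

/-! ## The step -/

/-- **The poisoning step** (registered stub `stub_step` of the line `Sketch` for the crux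
`FarFieldGapR`, from the octahedral-hole facts `hH` = stub `stub_hole`): for every separation
`δ ∈ (0, 3/5]` there is a cost `K = (2/δ + 1)³ · V_LJ(3/5) ≥ 0` such that every `δ`-separated
configuration `y` with a `1/20`-good particle `i` (witness `(a, A, P, f)`) admits the extra
particle `z = y i + a • A (e₀/√2)` with: `Fin.snoc y z` still `δ`-separated (clearance
`≥ a (1/√2 - 1/20) > 3/5`), strictly fewer good particles (`z` is poisoned, hence invisible to
all witnesses: it is bad, every good particle of `Fin.snoc y z` was good in `y`, and `i` turned
bad), and `𝓔(Fin.snoc y z) ≤ 𝓔(y) + K` (only the `≤ (2/δ + 1)³` particles within distance `1`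
of `z` interact positively, each by `≤ V_LJ(3/5)`). -/
theorem stub_step
    (hH : ∀ P : Finset (EuclideanSpace ℝ (Fin 3)), (P = fccTwoShellPattern ∨ P = hcpTwoShellPattern) →
      (∀ w ∈ P, (Real.sqrt 2)⁻¹ ≤
        dist w ((Real.sqrt 2)⁻¹ • EuclideanSpace.single (0 : Fin 3) (1 : ℝ))) ∧
      (∀ (m : Fin 3) (σ : ℝ), (σ = 1 ∨ σ = -1) →
        (Real.sqrt 2)⁻¹ • EuclideanSpace.single (0 : Fin 3) (1 : ℝ) +
            ((Real.sqrt 2)⁻¹ * σ) • EuclideanSpace.single m (1 : ℝ) ∈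
          insert (0 : EuclideanSpace ℝ (Fin 3)) P)) :
    ∀ δ : ℝ, 0 < δ → δ ≤ 3 / 5 → ∃ K : ℝ, 0 ≤ K ∧
      ∀ (n : ℕ) (y : Fin n → EuclideanSpace ℝ (Fin 3)),
        (∀ i j : Fin n, i ≠ j → δ ≤ dist (y i) (y j)) →
        (∃ k, IsTwoShellGood (1 / 20) (47 / 50) 1 y k) →
        ∃ z : EuclideanSpace ℝ (Fin 3),
          (∀ i j : Fin (n + 1), i ≠ j →
            δ ≤ dist (@Fin.snoc n (fun _ => EuclideanSpace ℝ (Fin 3)) y z i)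
              (@Fin.snoc n (fun _ => EuclideanSpace ℝ (Fin 3)) y z j)) ∧
          Nat.card {k : Fin (n + 1) //
              IsTwoShellGood (1 / 20) (47 / 50) 1 (@Fin.snoc n (fun _ => EuclideanSpace ℝ (Fin 3)) y z) k} <
            Nat.card {k : Fin n // IsTwoShellGood (1 / 20) (47 / 50) 1 y k} ∧
          interactionEnergy lennardJones (@Fin.snoc n (fun _ => EuclideanSpace ℝ (Fin 3)) y z) ≤
            interactionEnergy lennardJones y + K := by
  intro δ hδ hδ35
  have hV35 := step_lennardJones_three_fifths_nonneg
  refine ⟨(2 / δ + 1) ^ 3 * lennardJones (3 / 5), mul_nonneg (by positivity) hV35, ?_⟩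
  rintro n y hsep ⟨i, a, ha1, ha2, A, P, f, hP, hf, hinj, hcov⟩
  obtain ⟨hH1, hH2⟩ := hH P hP
  obtain ⟨hs2l, hs2u⟩ := step_inv_sqrt_two_bounds
  have ha0 : 0 ≤ a := by linarith
  have hs0 : 0 ≤ (Real.sqrt 2)⁻¹ := le_trans (by norm_num) hs2l
  have has : a * (Real.sqrt 2)⁻¹ ≤ 0.70711 := le_trans (mul_le_of_le_one_left hs0 ha2) hs2u
  have hone : ∀ m : Fin 3, ‖(EuclideanSpace.single m (1 : ℝ) : (EuclideanSpace ℝ (Fin 3)))‖ = 1 := fun m => by simp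
  -- the hole and the new particle
  set h : (EuclideanSpace ℝ (Fin 3)) := (Real.sqrt 2)⁻¹ • EuclideanSpace.single (0 : Fin 3) (1 : ℝ) with hh
  set z : (EuclideanSpace ℝ (Fin 3)) := y i + a • A h with hz
  have hhn : ‖h‖ = (Real.sqrt 2)⁻¹ := by
    rw [hh, norm_smul, hone, mul_one, Real.norm_of_nonneg hs0]
  have hiz : dist (y i) z = a * (Real.sqrt 2)⁻¹ := by
    rw [hz, dist_comm, dist_eq_norm, add_sub_cancel_left, norm_smul, A.norm_map, hhn,
      Real.norm_of_nonneg ha0]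
  -- (1) clearance
  have hclear : ∀ k : Fin n, a * ((Real.sqrt 2)⁻¹ - 1 / 20) ≤ dist (y k) z := by
    intro k
    by_cases hki : k = i
    · rw [hki, hiz]; nlinarith
    by_cases hk : dist (y k) (y i) ≤ 3 / 2 * a
    · obtain ⟨w, hw, hfw⟩ := hcov k hki hk
      have hmatch : dist (y k) (y i + a • A w) ≤ 1 / 20 * a := by
        have := (hf w hw).2; rwa [hfw] at this
      have hwz : dist (y i + a • A w) z = a * dist w h := by
        rw [hz, dist_eq_norm, add_sub_add_left_eq_sub, ← smul_sub, norm_smul,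
          Real.norm_of_nonneg ha0, ← map_sub, A.norm_map, dist_eq_norm]
      have hwh := hH1 w hw
      have htri := dist_triangle (y i + a • A w) (y k) z
      rw [hwz, dist_comm (y i + a • A w) (y k)] at htri
      nlinarith [mul_le_mul_of_nonneg_left hwh ha0]
    · push Not at hk
      have htri := dist_triangle (y k) z (y i)
      rw [dist_comm z (y i), hiz] at htri
      nlinarith
  have hclear' : ∀ k : Fin n, 3 / 5 < dist (y k) z := by
    intro k
    have h1 : 47 / 50 * (0.7071 - 1 / 20) ≤ a * ((Real.sqrt 2)⁻¹ - 1 / 20) :=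
      mul_le_mul ha1 (by linarith) (by norm_num) ha0
    have h2 := hclear k
    linarith
  -- the new configuration
  have hxc : ∀ k : Fin n, @Fin.snoc n (fun _ => (EuclideanSpace ℝ (Fin 3))) y z k.castSucc = y k := fun k =>
    Fin.snoc_castSucc (α := fun _ => (EuclideanSpace ℝ (Fin 3))) _ _ _
  have hxl : @Fin.snoc n (fun _ => (EuclideanSpace ℝ (Fin 3))) y z (Fin.last n) = z := Fin.snoc_last (α := fun _ => (EuclideanSpace ℝ (Fin 3))) _ _
  refine ⟨z, ?_, ?_, ?_⟩
  · -- (1') separation of `Fin.snoc y z`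
    intro p q hpq
    rcases Fin.eq_castSucc_or_eq_last p with ⟨p', rfl⟩ | rfl <;>
      rcases Fin.eq_castSucc_or_eq_last q with ⟨q', rfl⟩ | rfl
    · rw [hxc, hxc]
      exact hsep p' q' fun h => hpq (by rw [h])
    · rw [hxc, hxl]
      linarith [hclear' p']
    · rw [hxc, hxl, dist_comm]
      linarith [hclear' q']
    · exact absurd rfl hpq
  · -- (2) the good count drops
    -- `z` is poisoned in `Fin.snoc y z`
    have hpo : ∀ (m : Fin 3) (σ : ℝ), (σ = 1 ∨ σ = -1) →
        ∃ j, dist (@Fin.snoc n (fun _ => (EuclideanSpace ℝ (Fin 3))) y z j)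
          (@Fin.snoc n (fun _ => (EuclideanSpace ℝ (Fin 3))) y z (Fin.last n) +
            (a * ((Real.sqrt 2)⁻¹ * σ)) • A (EuclideanSpace.single m (1 : ℝ))) ≤ a / 20 := by
      intro m σ hσ
      have hw := hH2 m σ hσ
      set w : (EuclideanSpace ℝ (Fin 3)) := h + ((Real.sqrt 2)⁻¹ * σ) • EuclideanSpace.single m (1 : ℝ) with hw_def
      have hvertex : @Fin.snoc n (fun _ => (EuclideanSpace ℝ (Fin 3))) y z (Fin.last n) +
          (a * ((Real.sqrt 2)⁻¹ * σ)) • A (EuclideanSpace.single m (1 : ℝ)) = y i + a • A w := by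
        rw [hxl, hz, hw_def]
        simp only [map_add, LinearIsometry.map_smul, smul_add, smul_smul]
        abel
      rw [hvertex]
      rcases Finset.mem_insert.1 hw with hw0 | hwP
      · refine ⟨i.castSucc, ?_⟩
        rw [hxc, hw0, map_zero, smul_zero, add_zero, dist_self]
        positivity
      · refine ⟨(f w).castSucc, ?_⟩
        rw [hxc]
        have := (hf w hwP).2
        linarith
    -- invisibility of `z` for every witness of every particle
    -- (a) `z` is bad
    have hzbad : ¬ IsTwoShellGood (1 / 20) (47 / 50) 1 (@Fin.snoc n (fun _ => (EuclideanSpace ℝ (Fin 3))) y z) (Fin.last n) := by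
      rintro ⟨a', ha1', -, A', P', f', hP', hf', -, hcov'⟩
      have := (step_invisible _ (Fin.last n) ha1 ha2 A hpo (Fin.last n) ha1' A' P' f' hP' hf' hcov').2
      rw [dist_self] at this
      linarith
    -- (b) good old particles were good
    have hold : ∀ k : Fin n, IsTwoShellGood (1 / 20) (47 / 50) 1 (@Fin.snoc n (fun _ => (EuclideanSpace ℝ (Fin 3))) y z)
        k.castSucc → IsTwoShellGood (1 / 20) (47 / 50) 1 y k := by
      intro k hk
      refine step_good_restrict y z k hk fun a' A' P' f' ha1' hP' hf' hcov' => ?_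
      exact (step_invisible _ (Fin.last n) ha1 ha2 A hpo k.castSucc ha1' A' P' f' hP' hf' hcov').1
    -- (c) `i` turned bad
    have hibad : ¬ IsTwoShellGood (1 / 20) (47 / 50) 1 (@Fin.snoc n (fun _ => (EuclideanSpace ℝ (Fin 3))) y z) i.castSucc := by
      rintro ⟨a', ha1', -, A', P', f', hP', hf', -, hcov'⟩
      have := (step_invisible _ (Fin.last n) ha1 ha2 A hpo i.castSucc ha1' A' P' f' hP' hf' hcov').2
      rw [hxl, hxc, dist_comm, hiz] at this
      linarith
    -- counting
    have higood : IsTwoShellGood (1 / 20) (47 / 50) 1 y i := ⟨a, ha1, ha2, A, P, f, hP, hf, hinj, hcov⟩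
    rw [Nat.card_eq_fintype_card, Fintype.card_subtype, Nat.card_eq_fintype_card,
      Fintype.card_subtype]
    set Sy := Finset.univ.filter fun k : Fin n => IsTwoShellGood (1 / 20) (47 / 50) 1 y k with hSy
    have hiS : i ∈ Sy := by rw [hSy, Finset.mem_filter]; exact ⟨Finset.mem_univ _, higood⟩
    have hsub : (Finset.univ.filter fun k : Fin (n + 1) =>
        IsTwoShellGood (1 / 20) (47 / 50) 1 (@Fin.snoc n (fun _ => (EuclideanSpace ℝ (Fin 3))) y z) k) ⊆
        (Sy.erase i).map Fin.castSuccEmb := by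
      intro p hp
      rw [Finset.mem_filter] at hp
      rcases Fin.eq_castSucc_or_eq_last p with ⟨k, rfl⟩ | rfl
      · rw [Finset.mem_map]
        refine ⟨k, ?_, rfl⟩
        rw [Finset.mem_erase, hSy, Finset.mem_filter]
        refine ⟨fun hki => hibad ?_, Finset.mem_univ _, hold k hp.2⟩
        rw [← hki]; exact hp.2
      · exact absurd hp.2 hzbad
    have hcard := Finset.card_le_card hsub
    rw [Finset.card_map, Finset.card_erase_of_mem hiS] at hcard
    have hpos : 0 < Sy.card := Finset.card_pos.2 ⟨i, hiS⟩
    omega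
  · -- (3) the energy cost
    rw [step_energy_snoc]
    have hsplit := Finset.sum_filter_add_sum_filter_not Finset.univ
      (fun k : Fin n => dist (y k) z ≤ 1) (fun k => lennardJones (dist (y k) z))
    set F := Finset.univ.filter fun k : Fin n => dist (y k) z ≤ 1 with hF
    -- far particles attract
    have hfar : ∑ k ∈ Finset.univ.filter (fun k : Fin n => ¬ dist (y k) z ≤ 1),
        lennardJones (dist (y k) z) ≤ 0 := by
      refine Finset.sum_nonpos fun k hk => ?_
      rw [Finset.mem_filter] at hk
      exact lennardJones_nonpos (le_of_lt (not_le.1 hk.2))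
    -- near particles: at most `(2/δ + 1)³`, each `≤ V_LJ(3/5)`
    have hnear : ∑ k ∈ F, lennardJones (dist (y k) z) ≤ F.card * lennardJones (3 / 5) := by
      calc ∑ k ∈ F, lennardJones (dist (y k) z) ≤ ∑ _k ∈ F, lennardJones (3 / 5) :=
            Finset.sum_le_sum fun k _ => step_lennardJones_le (hclear' k).le
        _ = F.card * lennardJones (3 / 5) := by rw [Finset.sum_const, nsmul_eq_mul]
    have hcardF : (F.card : ℝ) ≤ (2 / δ + 1) ^ 3 := by
      have hinjOn : Set.InjOn y F := fun k _ l _ hkl => by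
        by_contra hne
        have := hsep k l hne
        rw [hkl, dist_self] at this
        exact absurd this (not_le.2 hδ)
      rw [← Finset.card_image_of_injOn hinjOn]
      have key := card_le_of_separated_of_dist_le (F.image y) z hδ zero_le_one ?_ ?_
      · rw [finrank_euclideanSpace_fin] at key
        simpa using key
      · intro c hc
        obtain ⟨k, hk, rfl⟩ := Finset.mem_image.1 hc
        rw [hF, Finset.mem_filter] at hk
        exact hk.2
      · intro c hc c' hc' hne
        obtain ⟨k, -, rfl⟩ := Finset.mem_image.1 hc
        obtain ⟨l, -, rfl⟩ := Finset.mem_image.1 hc'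
        exact hsep k l fun h => hne (h ▸ rfl)
    rw [← hsplit]
    nlinarith [mul_le_mul_of_nonneg_right hcardF hV35]

end Summit.AtomisticToContinuum.Crystallization.Theorems.PhononSlackCertificatesFarFieldGapR

end
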